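import Summits.HubbardSuperconductivity.HubbardSuperconductivity.Theorems.NodalWardXYPerturbedXYOrderReduction

/-!
# `PerturbedXYOrder` (stmt-HubbardSuperconductivity-10739) — line `schwarz-inheritance`, stub `stub_derivCratioZero`

**The linear response coefficient is the mixed covariance.**  For fixed `J, L, K` put
`Z(t) := Z_{tK} = ∫_cube w_J e^{t W_K}` and `N(t) := num_{tK} = Σ_{x,y} ∫_cube cos(θ_x − θ_y) w_J e^{t W_K}`
(`ent_Wk_smul : W_{tK} = t W_K`).  Differentiating under the integral sign at `t = 0` (finite measure, bounded continuous
integrands; the dominated-differentiation pattern of `ent_differentiable_integral_mul_cexp`, kept as a `HasDerivAt`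
statement in `dc_hasDerivAt_integral_mul_cexp_zero`) gives `Z'(0) = ∫ w_J W_K` and
`N'(0) = Σ_{x,y} ∫ cos(θ_x − θ_y) w_J W_K`; since `Z(0) = Z_0 > 0` (`even_Zk_zero_eq`, `integral_xyWeight_pos`) the quotient
rule (`HasDerivAt.fun_div`, `HasDerivAt.div_const`) yields
`d/dt cratio L J (tK) |_{t=0} = (N'(0) Z_0 − N(0) Z'(0)) / Z_0² / L⁶`, i.e. `L⁻⁶ Cov_{J,L}(Σ_{x,y} cos(θ_x − θ_y), W_K)` for the
normalised real Gibbs state.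
-/

noncomputable section

namespace Summit.HubbardSuperconductivity.HubbardSuperconductivity.Theorems.PerturbedXYOrder

open MeasureTheory Literature.Probability.LatticeModels
open Summit.HubbardSuperconductivity.HubbardSuperconductivity.Theses.NodalWardXY

/-- **Differentiation under the integral sign at `t = 0` (generic).** On a finite measure space, for bounded
a.e.-strongly measurable `g, W : α → ℂ`, the parametric integral `t ↦ ∫ g · exp(t W)` has derivative `∫ g · W` at `t = 0`
(dominated derivative `g W exp(t W)` on the unit ball, `hasDerivAt_integral_of_dominated_loc_of_deriv_le`). [folklore] -/
theorem dc_hasDerivAt_integral_mul_cexp_zero {α : Type*} [MeasurableSpace α] {μ : Measure α}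
    [IsFiniteMeasure μ] {g W : α → ℂ} (hg : AEStronglyMeasurable g μ)
    (hW : AEStronglyMeasurable W μ) {G M : ℝ} (hgb : ∀ a, ‖g a‖ ≤ G) (hWb : ∀ a, ‖W a‖ ≤ M) :
    HasDerivAt (fun t : ℂ => ∫ a, g a * Complex.exp (t * W a) ∂μ) (∫ a, g a * W a ∂μ) 0 := by
  -- measurability of the integrand and of its `t`-derivative
  have hmeas : ∀ t : ℂ, AEStronglyMeasurable (fun a => g a * Complex.exp (t * W a)) μ := fun t =>
    hg.mul (Complex.continuous_exp.comp_aestronglyMeasurable (hW.const_mul t))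
  have hmeas' : ∀ t : ℂ, AEStronglyMeasurable (fun a => g a * (Complex.exp (t * W a) * W a)) μ :=
    fun t => hg.mul ((Complex.continuous_exp.comp_aestronglyMeasurable (hW.const_mul t)).mul hW)
  -- the pointwise bound `‖g exp(tW) W‖ ≤ G e^{R M} M` for `‖t‖ ≤ R`
  have hexp : ∀ (t : ℂ) (R : ℝ), ‖t‖ ≤ R → ∀ a, ‖Complex.exp (t * W a)‖ ≤ Real.exp (R * M) := by
    intro t R htR a
    have hM0 : 0 ≤ M := (norm_nonneg _).trans (hWb a)
    refine (Complex.norm_exp_le_exp_norm _).trans (Real.exp_le_exp.2 ?_)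
    rw [norm_mul]
    exact mul_le_mul htR (hWb a) (norm_nonneg _) ((norm_nonneg _).trans htR)
  have hbd : ∀ (t : ℂ) (R : ℝ), ‖t‖ ≤ R → ∀ a,
      ‖g a * (Complex.exp (t * W a) * W a)‖ ≤ G * (Real.exp (R * M) * M) := by
    intro t R htR a
    have hG0 : 0 ≤ G := (norm_nonneg _).trans (hgb a)
    rw [norm_mul, norm_mul]
    exact mul_le_mul (hgb a) (mul_le_mul (hexp t R htR a) (hWb a) (norm_nonneg _) (Real.exp_nonneg _))
      (by positivity) hG0
  have key := hasDerivAt_integral_of_dominated_loc_of_deriv_le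
    (F := fun t a => g a * Complex.exp (t * W a)) (F' := fun t a => g a * (Complex.exp (t * W a) * W a))
    (x₀ := (0 : ℂ)) (bound := fun _ => G * (Real.exp ((‖(0 : ℂ)‖ + 1) * M) * M)) (s := Metric.ball (0 : ℂ) 1)
    (μ := μ) (Metric.ball_mem_nhds (0 : ℂ) one_pos) (Filter.Eventually.of_forall hmeas) ?_ (hmeas' 0) ?_
    (integrable_const _) ?_
  · -- the derivative integrand at `t = 0` is `g a * (exp 0 * W a) = g a * W a`
    refine key.2.congr_deriv (integral_congr_ae (ae_of_all _ fun a => ?_))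
    simp only [zero_mul, Complex.exp_zero, one_mul]
  · -- integrability of the integrand at `t = 0`: bounded on a finite measure
    refine Integrable.of_bound (hmeas 0) (G * Real.exp (‖(0 : ℂ)‖ * M)) (ae_of_all _ fun a => ?_)
    have hG0 : 0 ≤ G := (norm_nonneg _).trans (hgb a)
    rw [norm_mul]
    exact mul_le_mul (hgb a) (hexp 0 ‖(0 : ℂ)‖ le_rfl a) (norm_nonneg _) hG0
  · refine ae_of_all _ fun a t ht => hbd t (‖(0 : ℂ)‖ + 1) ?_ a
    have h1 : ‖t - 0‖ < 1 := by rwa [Metric.mem_ball, dist_eq_norm] at ht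
    have h2 : ‖t‖ - ‖(0 : ℂ)‖ ≤ ‖t - 0‖ := norm_sub_norm_le t 0
    linarith
  · exact ae_of_all _ fun a t _ => ((hasDerivAt_mul_const (W a)).cexp).const_mul (g a)

/-- **The linear response coefficient is the mixed covariance.** At `t = 0`,
`d/dt [num(tK)/Z(tK)/L⁶] = (num₁ Z_0 − num_0 Z₁)/Z_0²/L⁶` with `Z₁ = ∫ w_J W_K`, `num₁ = Σ_{x,y} ∫ cos(θ_x − θ_y) w_J W_K`
(differentiation under the integral sign at `t = 0`, `dc_hasDerivAt_integral_mul_cexp_zero`, then the quotient rule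
`HasDerivAt.fun_div` with `Z_0 ≠ 0` from `even_Zk_zero_eq` / `integral_xyWeight_pos`, and `HasDerivAt.div_const`);
i.e. `L⁻⁶ Cov_{J,L}(Σ_{x,y} cos(θ_x − θ_y), W_K)` for the normalised real Gibbs state. -/
theorem stub_derivCratioZero (J : ℝ) (L : ℕ) [NeZero L] (K : Bond L → Bond L → ℂ) :
    HasDerivAt (fun t : ℂ => cratio L J (t • K))
      (((∑ x : TorusSite 3 L, ∑ y : TorusSite 3 L,
            ∫ θ in cube L, (Real.cos (θ x - θ y) : ℂ) * (wJ J θ * Wk K θ)) * Zk J (0 : Bond L → Bond L → ℂ) -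
          num J (0 : Bond L → Bond L → ℂ) * ∫ θ in cube L, wJ J θ * Wk K θ) /
        (Zk J (0 : Bond L → Bond L → ℂ)) ^ 2 / ((L : ℂ) ^ 6)) 0 := by
  haveI := ent_isFiniteMeasure_restrict_cube (L := L)
  have hwJ : AEStronglyMeasurable (wJ (L := L) J) (volume.restrict (cube L)) :=
    (ent_continuous_wJ J).aestronglyMeasurable
  have hWk : AEStronglyMeasurable (Wk K) (volume.restrict (cube L)) :=
    (ent_continuous_Wk K).aestronglyMeasurable
  -- `Z(t) = ∫ w_J exp(t W_K)` and its derivative at `0`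
  have hZfun : (fun t : ℂ => Zk J (t • K)) =
      fun t => ∫ θ, wJ J θ * Complex.exp (t * Wk K θ) ∂(volume.restrict (cube L)) := by
    funext t; unfold Zk; simp_rw [ent_Wk_smul]
  have hZ : HasDerivAt (fun t : ℂ => Zk J (t • K)) (∫ θ in cube L, wJ J θ * Wk K θ) 0 := by
    rw [hZfun]
    exact dc_hasDerivAt_integral_mul_cexp_zero hwJ hWk (ent_norm_wJ_le J) (ent_norm_Wk_le K)
  -- `N(t) = Σ_{x,y} ∫ cos(θ_x − θ_y) w_J exp(t W_K)` and its derivative at `0`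
  have hNfun : (fun t : ℂ => num J (t • K)) = fun t => ∑ x : TorusSite 3 L, ∑ y : TorusSite 3 L,
      ∫ θ, ((Real.cos (θ x - θ y) : ℂ) * wJ J θ) * Complex.exp (t * Wk K θ) ∂(volume.restrict (cube L)) := by
    funext t; unfold num; simp_rw [ent_Wk_smul, mul_assoc]
  have hxy : ∀ x y : TorusSite 3 L,
      HasDerivAt (fun t : ℂ => ∫ θ, ((Real.cos (θ x - θ y) : ℂ) * wJ J θ) * Complex.exp (t * Wk K θ)
          ∂(volume.restrict (cube L)))
        (∫ θ in cube L, (Real.cos (θ x - θ y) : ℂ) * (wJ J θ * Wk K θ)) 0 := by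
    intro x y
    have hcos : Continuous fun θ : TorusSite 3 L → ℝ => ((Real.cos (θ x - θ y) : ℝ) : ℂ) := by fun_prop
    have hgb : ∀ θ : TorusSite 3 L → ℝ,
        ‖((Real.cos (θ x - θ y) : ℝ) : ℂ) * wJ J θ‖ ≤ 1 * Real.exp (|J| * ∑ _b : Bond L, (1 : ℝ)) := by
      intro θ
      rw [norm_mul]
      refine mul_le_mul ?_ (ent_norm_wJ_le J θ) (norm_nonneg _) zero_le_one
      rw [Complex.norm_real, Real.norm_eq_abs]; exact Real.abs_cos_le_one _
    refine (dc_hasDerivAt_integral_mul_cexp_zero (hcos.aestronglyMeasurable.mul hwJ) hWk hgb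
      (ent_norm_Wk_le K)).congr_deriv (integral_congr_ae (ae_of_all _ fun θ => ?_))
    exact mul_assoc _ _ _
  have hN : HasDerivAt (fun t : ℂ => num J (t • K))
      (∑ x : TorusSite 3 L, ∑ y : TorusSite 3 L,
        ∫ θ in cube L, (Real.cos (θ x - θ y) : ℂ) * (wJ J θ * Wk K θ)) 0 := by
    rw [hNfun]
    exact HasDerivAt.fun_sum fun x _ => HasDerivAt.fun_sum fun y _ => hxy x y
  -- `Z(0) = Z_0 ≠ 0`
  have hZ0 : Zk J (0 : Bond L → Bond L → ℂ) ≠ 0 := by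
    rw [even_Zk_zero_eq, Ne, Complex.ofReal_eq_zero]
    exact (integral_xyWeight_pos (L := L) J).ne'
  have hZ0' : (fun t : ℂ => Zk J (t • K)) 0 ≠ 0 := by
    simp only [zero_smul]; exact hZ0
  -- quotient rule, then division by the constant `L⁶`
  have key := (hN.fun_div hZ hZ0').div_const ((L : ℂ) ^ 6)
  simp only [zero_smul] at key
  exact key

end Summit.HubbardSuperconductivity.HubbardSuperconductivity.Theorems.PerturbedXYOrder

end
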